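import Literature.MathematicalPhysics.QuantumFieldTheory.Balaban1983to89.B11Eq73KernelColumnsTwoBackgrounds

/-!
# `Balaban1983to89.B11Eq88KernelColumnsCompositeTwoBackgrounds` — T. Bałaban, *The variational problem and background fields in renormalization group method for lattice
# gauge theories*, Commun. Math. Phys. **102** (1985) 277–309 [Balaban1985Variational] (87)–(88) p. 291 («Applying the inequalities (3.132) from [5], (55), (73) … we can estimate this
# functional derivative by O(1)ε₁(Lʲη)⁻³ on Ω_j»), (63)–(73) pp. 287–289, Prop. 6 (117)–(120) p. 295, with [Balaban1985BackgroundPropagators] Thm 3.4 p. 400: **THE COLUMNS OF THE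
# COMPOSITE `N₁∘(HD)′₁(P₁) − N₂∘(HD)′₂(P₂)` BETWEEN TWO CARRIERS (115) — the letter `δθ′` of this lineage's `B11Eq98W80TwoBackgroundLetters`** (the transposed W₂-row of (88) read
# through the (27)-symmetry of `Δπ`): from (68) on each carrier, `N₁K₁δ¹_bX − N₂K₂δ²_bX = Σ_y(N₁H₁ − N₂H₂)δ_yg₁(y) + Σ_yN₂H₂δ_y(g₁ − g₂)(y)`, so the `r`-weighted columns are bounded
# by the weighted columns `δΘ′^r` of the two-background one-block letter `δhk′` of the COMPOSITE `N∘H` (`‖(N₁H₁δ_yZ)(b′) − (N₂H₂δ_yZ)(b′)‖ ≤ δhk′(b′,y)‖Z‖`), `Θ′₂^r` of `hk′₂`, and the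
# letters `δΘ, δG` of the sibling file — the two-background twin of this lineage's `B11Eq88KernelColumnsComposite.colSum_weighted_comp_fderiv_Emap_le` (gen 98), NO operator norm
# `‖Δπ‖`, NO lattice count

statement-level skeleton of published theorems with citation tags; proofs where landed; nothing here is a claim about the Yang–Mills mass gap

CITATION HEADER (lean-in-tree rule).  Audit cell `pub-balaban`, sub-cell `t4`, BINDER row NE9; filed by NE9 crux-team LEAF PROVER 01 (`b2b-balaban-t4-ne9-formalise-leaf-01`,
gen 105; ROUTE (J′), the `δ_W` brick; bears_on: R4/N22).  Composition BY NAME: the sibling `B11Eq73KernelColumnsTwoBackgrounds.{norm_gvec_apply_le, norm_gvec_sub_apply_le,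
colSum_kernel_sub_le}`, this lineage's `B11Eq73KernelColumnsCarrier.{negSup_sum_single, fderiv_Emap_eq, colSum_kernel_fderiv_Emap_le}`.  Source READ first-hand in the held text layer
`paper:balaban1985-cmp102-variational-background` (journal page = PDF page + 276) pp. 287–291.  NOTHING of print's proofs is reproduced: [folklore] majorant algebra.

WHAT IS PROVED (sorry-free; proof lane — 0 `def`; [folklore]).  `norm_equiv_comp_kernel_sub_apply_le` (entrywise), **`colSum_weighted_comp_kernel_sub_le`**:
`Σ_{b′}r(b′)‖(N₁(K₁δ¹_bX))(b′) − (N₂(K₂δ²_bX))(b′)‖ ≤ [2(ε_C + a_C)δΘ′^rG₁ + Θ′₂^r(2δG + 4(ε_C + a_C)G₂((ε_C + a_C)δΘG₁ + Θ_{H,2}δG))]·‖X‖`.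
HONEST SCOPE.  Mechanism only: every letter DISPLAYED (lattice-free suppliers = this lineage's next files); nothing of [B11] (63)–(73), (88) ∕ Prop. 6 or [B9] Thm 3.4 asserted as
printed; «NE9 ⇐ the named binders»; NE9 NOT PRINTED ∕ NOT PROVED; spine PROVED 0∕9; rung (B)+1 finite T⁴ — NOT infinite volume, NOT mass gap, NOT BetaPertH, NOT Clay.  HONEST
DEPENDENCY: continuum YM on T⁴ ⇐ BetaPertH ∧ nine spine estimates (0/9 proved); BetaPertH ⇐ (D1) ∧ (D4) ∧ CAP+tail; G-an2-4 gates asym, D1 and NE2/3/4.  NEW file; nothing modified.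
Net new unproved facts: 0.
-/

noncomputable section

open scoped BigOperators
open Finset Metric Set Filter Topology

namespace Literature.MathematicalPhysics.QuantumFieldTheory.Balaban1983to89.B11Eq88KernelColumnsCompositeTwoBackgrounds

open Literature.MathematicalPhysics.QuantumFieldTheory.Balaban1983to89.B11Prop6Scheme (Prop4Hyp)
open Literature.MathematicalPhysics.QuantumFieldTheory.Balaban1983to89.B11Eq174Chart (solA Regime)
open Literature.MathematicalPhysics.QuantumFieldTheory.Balaban1983to89.B11Eq90Transpose (kernel kernel_apply single115 sum_single115 flat115_single115)
open Literature.MathematicalPhysics.QuantumFieldTheory.Balaban1983to89.B11Eq90V0primeCurrent (flat115 flat115_apply)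
open Literature.MathematicalPhysics.QuantumFieldTheory.Balaban1983to89.B11Eq90V0GroupComposed (T47 T47_apply norm_T47_le norm_T47_lt)
open Literature.MathematicalPhysics.QuantumFieldTheory.Balaban1983to89.B11Eq80Current (Emap Emap_eq_H)
open Literature.MathematicalPhysics.QuantumFieldTheory.Balaban1983to89.B11Eq73KernelColumnsCarrier (negSup_sum_single flat_apply_eq_sum_single
  negSup_apply_eq_sum_single fderiv_Emap_eq colSum_kernel_fderiv_Emap_le)
open Literature.MathematicalPhysics.QuantumFieldTheory.Balaban1983to89.B11Eq73KernelColumnsTwoBackgrounds (norm_gvec_apply_le norm_gvec_sub_apply_le colSum_kernel_sub_le)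
open B9SectCLatticeCarrier (Bond)
open B11Eq115Space

variable {𝔸 : Type*} [NormedRing 𝔸] [NormedAlgebra ℂ 𝔸] [FiniteDimensional ℂ 𝔸]
variable {d : ℕ} {Pd : Fin d → ℕ} {L η : ℝ} [Fact (0 < L)] [Fact (0 < η)] {lev₀ : Bond d Pd → ℕ} {κ' : Type*} [Fintype κ']
  {lev₁ : κ' → ℕ} {Dc₁ Dc₂ : (Bond d Pd → 𝔸) →ₗ[ℂ] (κ' → 𝔸)}
variable {β : Type*} [Fintype β] [DecidableEq β] {wB : β → ℝ} [Fact (∀ y, 0 < wB y)]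
variable {γ : Type*} [Fintype γ] {w' : γ → ℝ} [Fact (∀ i, 0 < w' i)]

variable {H₁ : NegSup wB 𝔸 →L[ℂ] Space115 L η lev₀ lev₁ Dc₁} {C₁ : Space115 L η lev₀ lev₁ Dc₁ → NegSup wB 𝔸}
  {H₂ : NegSup wB 𝔸 →L[ℂ] Space115 L η lev₀ lev₁ Dc₂} {C₂' : Space115 L η lev₀ lev₁ Dc₂ → NegSup wB 𝔸} {b C₂ c₄ aC εC : ℝ}
  (RC₁ : Regime H₁ 0 C₁ b 0 C₂ c₄ 0 aC εC) (hC₁ : Prop4Hyp C₁ C₂ c₄) (RC₂ : Regime H₂ 0 C₂' b 0 C₂ c₄ 0 aC εC) (hC₂ : Prop4Hyp C₂' C₂ c₄)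
  -- the one-background letters of carrier 1: the one-block letter of `H₁`, its plain fine column, the entrywise letter of `𝒞′₁`, its coarse column, the window
  {hk₁ : Bond d Pd → β → ℝ} (hk₁0 : ∀ b' y, 0 ≤ hk₁ b' y)
  (hHk₁ : ∀ (y : β) (Z : 𝔸) (b' : Bond d Pd), ‖flat115 (H₁ ((NegSup.equiv wB 𝔸).symm (Pi.single y Z))) b'‖ ≤ hk₁ b' y * ‖Z‖)
  {ΘH₁ : ℝ} (hH1₁ : ∀ y, ∑ b', hk₁ b' y ≤ ΘH₁)
  {gC₁ : β → Bond d Pd → ℝ} (hgC₁0 : ∀ y bb, 0 ≤ gC₁ y bb)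
  (hCg₁ : ∀ A : Space115 L η lev₀ lev₁ Dc₁, ‖A‖ < εC + aC → ∀ (bb : Bond d Pd) (X : 𝔸) (y : β),
      ‖NegSup.equiv wB 𝔸 (fderiv ℂ C₁ A (single115 (lev₁ := lev₁) (Dc := Dc₁) bb X)) y‖ ≤ gC₁ y bb * ‖A‖ * ‖X‖)
  {G₁ : ℝ} (hG₁ : ∀ bb, ∑ y, gC₁ y bb ≤ G₁) (hq₁ : (εC + aC) * ΘH₁ * G₁ ≤ 1 / 2)
  -- the one-background letters of carrier 2
  {hk₂ : Bond d Pd → β → ℝ} (hk₂0 : ∀ b' y, 0 ≤ hk₂ b' y)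
  (hHk₂ : ∀ (y : β) (Z : 𝔸) (b' : Bond d Pd), ‖flat115 (H₂ ((NegSup.equiv wB 𝔸).symm (Pi.single y Z))) b'‖ ≤ hk₂ b' y * ‖Z‖)
  {ΘH₂ : ℝ} (hH1₂ : ∀ y, ∑ b', hk₂ b' y ≤ ΘH₂)
  {gC₂ : β → Bond d Pd → ℝ} (hgC₂0 : ∀ y bb, 0 ≤ gC₂ y bb)
  (hCg₂ : ∀ A : Space115 L η lev₀ lev₁ Dc₂, ‖A‖ < εC + aC → ∀ (bb : Bond d Pd) (X : 𝔸) (y : β),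
      ‖NegSup.equiv wB 𝔸 (fderiv ℂ C₂' A (single115 (lev₁ := lev₁) (Dc := Dc₂) bb X)) y‖ ≤ gC₂ y bb * ‖A‖ * ‖X‖)
  {G₂ : ℝ} (hG₂ : ∀ bb, ∑ y, gC₂ y bb ≤ G₂) (hq₂ : (εC + aC) * ΘH₂ * G₂ ≤ 1 / 2)
  -- the pair of configurations and the two-background letters: `δhk` of `H₁ − H₂`, `δg` of `𝒞′₁(A₁) − 𝒞′₂(A₂)`
  {P₁ : Space115 L η lev₀ lev₁ Dc₁} {P₂ : Space115 L η lev₀ lev₁ Dc₂} (hP₁ : ‖P₁‖ < aC) (hP₂ : ‖P₂‖ < aC)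
  {δhk : Bond d Pd → β → ℝ} (hδhk0 : ∀ b' y, 0 ≤ δhk b' y)
  (hδH : ∀ (y : β) (Z : 𝔸) (b' : Bond d Pd), ‖flat115 (H₁ ((NegSup.equiv wB 𝔸).symm (Pi.single y Z))) b' -
    flat115 (H₂ ((NegSup.equiv wB 𝔸).symm (Pi.single y Z))) b'‖ ≤ δhk b' y * ‖Z‖)
  {δg : β → Bond d Pd → ℝ} (hδg0 : ∀ y bb, 0 ≤ δg y bb)
  (hδg : ∀ (bb : Bond d Pd) (X : 𝔸) (y : β), ‖NegSup.equiv wB 𝔸 (fderiv ℂ C₁ (T47 H₁ C₁ εC P₁) (single115 (lev₁ := lev₁) (Dc := Dc₁) bb X)) y -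
    NegSup.equiv wB 𝔸 (fderiv ℂ C₂' (T47 H₂ C₂' εC P₂) (single115 (lev₁ := lev₁) (Dc := Dc₂) bb X)) y‖ ≤ δg y bb * ‖X‖)
  {δG : ℝ} (hδG : ∀ bb, ∑ y, δg y bb ≤ δG)

/-! ## The columns of the COMPOSITE `N₁∘(HD)′₁(P₁) − N₂∘(HD)′₂(P₂)`: the letter `δθ′` -/

variable (N₁ : Space115 L η lev₀ lev₁ Dc₁ →L[ℂ] NegSup w' 𝔸) (N₂ : Space115 L η lev₀ lev₁ Dc₂ →L[ℂ] NegSup w' 𝔸)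
  {hk'₂ : γ → β → ℝ} (hk'₂0 : ∀ b' y, 0 ≤ hk'₂ b' y)
  (hNk₂ : ∀ (y : β) (Z : 𝔸) (b' : γ), ‖NegSup.equiv w' 𝔸 (N₂ (H₂ ((NegSup.equiv wB 𝔸).symm (Pi.single y Z)))) b'‖ ≤ hk'₂ b' y * ‖Z‖)
  {δhk' : γ → β → ℝ} (hδhk'0 : ∀ b' y, 0 ≤ δhk' b' y)
  (hδN : ∀ (y : β) (Z : 𝔸) (b' : γ), ‖NegSup.equiv w' 𝔸 (N₁ (H₁ ((NegSup.equiv wB 𝔸).symm (Pi.single y Z)))) b' -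
    NegSup.equiv w' 𝔸 (N₂ (H₂ ((NegSup.equiv wB 𝔸).symm (Pi.single y Z)))) b'‖ ≤ δhk' b' y * ‖Z‖)

include RC₁ hC₁ RC₂ hC₂ hgC₁0 hCg₁ hgC₂0 hCg₂ hP₁ hP₂ hδg0 hδg hk'₂0 hNk₂ hδhk'0 hδN in
/-- **THE ENTRYWISE MAJORANT FOR THE COMPOSITE DIFFERENCE**: `(N₁(K₁δ¹_bX))(b′) − (N₂(K₂δ²_bX))(b′) = Σ_y[(N₁H₁ − N₂H₂)δ_yg₁(y)](b′) + Σ_y[N₂H₂δ_y(g₁ − g₂)(y)](b′)`, so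
its norm is `≤ (‖A₁‖Σ_yδhk′(b′,y)T₁(y) + Σ_yhk′₂(b′,y)D(y))‖X‖` with §2's `T₁`, `D`. [cite: Balaban1985Variational, (68)–(69) p.288, (88) p.291, Prop. 6 (117) p.295] -/
theorem norm_equiv_comp_kernel_sub_apply_le (bb : Bond d Pd) (X : 𝔸) (b' : γ) :
    ‖NegSup.equiv w' 𝔸 (N₁ (fderiv ℂ (Emap H₁ C₁ εC) P₁ (single115 (lev₁ := lev₁) (Dc := Dc₁) bb X))) b' -
        NegSup.equiv w' 𝔸 (N₂ (fderiv ℂ (Emap H₂ C₂' εC) P₂ (single115 (lev₁ := lev₁) (Dc := Dc₂) bb X))) b'‖ ≤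
      (‖T47 H₁ C₁ εC P₁‖ * ∑ y, δhk' b' y * (gC₁ y bb + ∑ b'', gC₁ y b'' * ‖kernel (fderiv ℂ (Emap H₁ C₁ εC) P₁) b'' bb‖) +
      ∑ y, hk'₂ b' y * ((δg y bb + ∑ b'', δg y b'' * ‖kernel (fderiv ℂ (Emap H₁ C₁ εC) P₁) b'' bb‖) +
        ‖T47 H₂ C₂' εC P₂‖ * ∑ b'', gC₂ y b'' * ‖kernel (fderiv ℂ (Emap H₁ C₁ εC) P₁) b'' bb - kernel (fderiv ℂ (Emap H₂ C₂' εC) P₂) b'' bb‖)) * ‖X‖ := by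
  set K₁ := fderiv ℂ (Emap H₁ C₁ εC) P₁ with hK₁
  set K₂ := fderiv ℂ (Emap H₂ C₂' εC) P₂ with hK₂
  set T₁ : β → ℝ := fun y => gC₁ y bb + ∑ b'', gC₁ y b'' * ‖kernel K₁ b'' bb‖ with hT₁
  set D : β → ℝ := fun y => (δg y bb + ∑ b'', δg y b'' * ‖kernel K₁ b'' bb‖) +
    ‖T47 H₂ C₂' εC P₂‖ * ∑ b'', gC₂ y b'' * ‖kernel K₁ b'' bb - kernel K₂ b'' bb‖ with hD
  set g₁ : NegSup wB 𝔸 := fderiv ℂ C₁ (T47 H₁ C₁ εC P₁) (single115 (lev₁ := lev₁) (Dc := Dc₁) bb X - K₁ (single115 (lev₁ := lev₁) (Dc := Dc₁) bb X)) with hg₁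
  set g₂ : NegSup wB 𝔸 := fderiv ℂ C₂' (T47 H₂ C₂' εC P₂) (single115 (lev₁ := lev₁) (Dc := Dc₂) bb X - K₂ (single115 (lev₁ := lev₁) (Dc := Dc₂) bb X)) with hg₂
  have hKX₁ : K₁ (single115 (lev₁ := lev₁) (Dc := Dc₁) bb X) = H₁ g₁ := by
    conv_lhs => rw [hK₁, fderiv_Emap_eq RC₁ hC₁ hP₁]
    rfl
  have hKX₂ : K₂ (single115 (lev₁ := lev₁) (Dc := Dc₂) bb X) = H₂ g₂ := by
    conv_lhs => rw [hK₂, fderiv_Emap_eq RC₂ hC₂ hP₂]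
    rfl
  have hgy : ∀ y, ‖NegSup.equiv wB 𝔸 g₁ y‖ ≤ ‖T47 H₁ C₁ εC P₁‖ * T₁ y * ‖X‖ := fun y =>
    norm_gvec_apply_le RC₁ hgC₁0 hCg₁ hP₁ bb X y
  have hgdy : ∀ y, ‖NegSup.equiv wB 𝔸 (g₁ - g₂) y‖ ≤ D y * ‖X‖ := fun y => by
    rw [NegSup.equiv_sub, Pi.sub_apply]; exact norm_gvec_sub_apply_le RC₂ hgC₂0 hCg₂ hP₂ hδg0 hδg bb X y
  -- decompositions `N_i(H_i g) = Σ_y N_i(H_i δ_y g(y))` at `b′`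
  have hdec : ∀ (Φ : NegSup wB 𝔸 →L[ℂ] NegSup w' 𝔸) (g : NegSup wB 𝔸),
      NegSup.equiv w' 𝔸 (Φ g) b' = ∑ y, NegSup.equiv w' 𝔸 (Φ ((NegSup.equiv wB 𝔸).symm (Pi.single y (NegSup.equiv wB 𝔸 g y)))) b' := fun Φ g => by
    conv_lhs => rw [← negSup_sum_single g]
    rw [map_sum, ← NegSup.evalCLM_apply (𝕜 := ℂ), map_sum]
    simp only [NegSup.evalCLM_apply]
  have e : NegSup.equiv w' 𝔸 (N₁ (K₁ (single115 (lev₁ := lev₁) (Dc := Dc₁) bb X))) b' - NegSup.equiv w' 𝔸 (N₂ (K₂ (single115 (lev₁ := lev₁) (Dc := Dc₂) bb X))) b' =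
      ∑ y, (NegSup.equiv w' 𝔸 ((N₁.comp H₁) ((NegSup.equiv wB 𝔸).symm (Pi.single y (NegSup.equiv wB 𝔸 g₁ y)))) b' -
        NegSup.equiv w' 𝔸 ((N₂.comp H₂) ((NegSup.equiv wB 𝔸).symm (Pi.single y (NegSup.equiv wB 𝔸 g₁ y)))) b') +
      ∑ y, NegSup.equiv w' 𝔸 ((N₂.comp H₂) ((NegSup.equiv wB 𝔸).symm (Pi.single y (NegSup.equiv wB 𝔸 (g₁ - g₂) y)))) b' := by
    rw [hKX₁, hKX₂, show N₁ (H₁ g₁) = (N₁.comp H₁) g₁ from rfl, show N₂ (H₂ g₂) = (N₂.comp H₂) g₁ - (N₂.comp H₂) (g₁ - g₂) by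
      rw [map_sub, sub_sub_cancel]; rfl, NegSup.equiv_sub, Pi.sub_apply, hdec (N₁.comp H₁) g₁, hdec (N₂.comp H₂) g₁, hdec (N₂.comp H₂) (g₁ - g₂),
      Finset.sum_sub_distrib]
    abel
  rw [e]
  calc _ ≤ ‖∑ y, (NegSup.equiv w' 𝔸 ((N₁.comp H₁) ((NegSup.equiv wB 𝔸).symm (Pi.single y (NegSup.equiv wB 𝔸 g₁ y)))) b' -
          NegSup.equiv w' 𝔸 ((N₂.comp H₂) ((NegSup.equiv wB 𝔸).symm (Pi.single y (NegSup.equiv wB 𝔸 g₁ y)))) b')‖ +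
        ‖∑ y, NegSup.equiv w' 𝔸 ((N₂.comp H₂) ((NegSup.equiv wB 𝔸).symm (Pi.single y (NegSup.equiv wB 𝔸 (g₁ - g₂) y)))) b'‖ := norm_add_le _ _
    _ ≤ ∑ y, δhk' b' y * ‖NegSup.equiv wB 𝔸 g₁ y‖ + ∑ y, hk'₂ b' y * ‖NegSup.equiv wB 𝔸 (g₁ - g₂) y‖ :=
        add_le_add ((norm_sum_le _ _).trans (Finset.sum_le_sum fun y _ => hδN y _ b'))
          ((norm_sum_le _ _).trans (Finset.sum_le_sum fun y _ => hNk₂ y _ b'))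
    _ ≤ ∑ y, δhk' b' y * (‖T47 H₁ C₁ εC P₁‖ * T₁ y * ‖X‖) + ∑ y, hk'₂ b' y * (D y * ‖X‖) :=
        add_le_add (Finset.sum_le_sum fun y _ => mul_le_mul_of_nonneg_left (hgy y) (hδhk'0 _ _))
          (Finset.sum_le_sum fun y _ => mul_le_mul_of_nonneg_left (hgdy y) (hk'₂0 _ _))
    _ = _ := by
        rw [add_mul, Finset.mul_sum, Finset.sum_mul, Finset.sum_mul]
        congr 1 <;> exact Finset.sum_congr rfl fun y _ => by ring

include RC₁ hC₁ RC₂ hC₂ hk₁0 hHk₁ hH1₁ hgC₁0 hCg₁ hG₁ hq₁ hk₂0 hHk₂ hH1₂ hgC₂0 hCg₂ hG₂ hq₂ hP₁ hP₂ hδhk0 hδH hδg0 hδg hδG hk'₂0 hNk₂ hδhk'0 hδN in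
/-- **THE WEIGHTED COLUMN LETTER `δθ′` OF THE COMPOSITE DIFFERENCE** — the binder `hδΘ′` of `B11Eq98W80TwoBackgroundLetters.norm_W80_sub_W80_le_pair`: for a weight `r ≥ 0` on
the target with `Σ_{b′}r(b′)δhk′(b′,y) ≤ δΘ′^r`, `Σ_{b′}r(b′)hk′₂(b′,y) ≤ Θ′₂^r`:
`Σ_{b′}r(b′)‖(N₁(K₁δ¹_bX))(b′) − (N₂(K₂δ²_bX))(b′)‖ ≤ [2(ε_C + a_C)δΘ′^rG₁ + Θ′₂^r(2δG + 4(ε_C + a_C)G₂((ε_C + a_C)δΘG₁ + Θ_{H,2}δG))]·‖X‖`.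
[cite: Balaban1985Variational, (73) p.289, (88) p.291, Prop. 6 (117)–(120) p.295] -/
theorem colSum_weighted_comp_kernel_sub_le (hΘH₁ : 0 ≤ ΘH₁) (hΘH₂ : 0 ≤ ΘH₂) {δΘ : ℝ} (hδΘ0 : 0 ≤ δΘ) (hδΘ : ∀ y, ∑ b', δhk b' y ≤ δΘ)
    (bb : Bond d Pd) {r : γ → ℝ} (hr : ∀ b', 0 ≤ r b') {δΘ'r Θ'₂r : ℝ} (hδΘ'r0 : 0 ≤ δΘ'r) (hΘ'₂r0 : 0 ≤ Θ'₂r)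
    (hδΘ'r : ∀ y, ∑ b', r b' * δhk' b' y ≤ δΘ'r) (hΘ'₂r : ∀ y, ∑ b', r b' * hk'₂ b' y ≤ Θ'₂r) (X : 𝔸) :
    ∑ b', r b' * ‖NegSup.equiv w' 𝔸 (N₁ (fderiv ℂ (Emap H₁ C₁ εC) P₁ (single115 (lev₁ := lev₁) (Dc := Dc₁) bb X))) b' -
        NegSup.equiv w' 𝔸 (N₂ (fderiv ℂ (Emap H₂ C₂' εC) P₂ (single115 (lev₁ := lev₁) (Dc := Dc₂) bb X))) b'‖ ≤
      (2 * (εC + aC) * δΘ'r * G₁ + Θ'₂r * (2 * δG + 4 * (εC + aC) * G₂ * ((εC + aC) * δΘ * G₁ + ΘH₂ * δG))) * ‖X‖ := by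
  set K₁ := fderiv ℂ (Emap H₁ C₁ εC) P₁ with hK₁
  set K₂ := fderiv ℂ (Emap H₂ C₂' εC) P₂ with hK₂
  set T₁ : β → ℝ := fun y => gC₁ y bb + ∑ b'', gC₁ y b'' * ‖kernel K₁ b'' bb‖ with hT₁
  set D : β → ℝ := fun y => (δg y bb + ∑ b'', δg y b'' * ‖kernel K₁ b'' bb‖) +
    ‖T47 H₂ C₂' εC P₂‖ * ∑ b'', gC₂ y b'' * ‖kernel K₁ b'' bb - kernel K₂ b'' bb‖ with hD
  set U₁ : ℝ := ∑ b'', ‖kernel K₁ b'' bb‖ with hU₁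
  set Uδ : ℝ := ∑ b'', ‖kernel K₁ b'' bb - kernel K₂ b'' bb‖ with hUδ
  have hT₁0 : ∀ y, 0 ≤ T₁ y := fun y => add_nonneg (hgC₁0 _ _) (Finset.sum_nonneg fun _ _ => mul_nonneg (hgC₁0 _ _) (norm_nonneg _))
  have hD0 : ∀ y, 0 ≤ D y := fun y => add_nonneg (add_nonneg (hδg0 _ _) (Finset.sum_nonneg fun _ _ => mul_nonneg (hδg0 _ _) (norm_nonneg _)))
    (mul_nonneg (norm_nonneg (T47 H₂ C₂' εC P₂)) (Finset.sum_nonneg fun _ _ => mul_nonneg (hgC₂0 _ _) (norm_nonneg _)))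
  have hG₁0 : 0 ≤ G₁ := (Finset.sum_nonneg fun y _ => hgC₁0 y bb).trans (hG₁ bb)
  have hG₂0 : 0 ≤ G₂ := (Finset.sum_nonneg fun y _ => hgC₂0 y bb).trans (hG₂ bb)
  have hδG0 : 0 ≤ δG := (Finset.sum_nonneg fun y _ => hδg0 y bb).trans (hδG bb)
  have hA₁ : ‖T47 H₁ C₁ εC P₁‖ ≤ εC + aC := (norm_T47_lt RC₁ hP₁).le
  have hA₂ : ‖T47 H₂ C₂' εC P₂‖ ≤ εC + aC := (norm_T47_lt RC₂ hP₂).le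
  have hU1 : U₁ ≤ 1 := by
    have h := colSum_kernel_fderiv_Emap_le RC₁ hC₁ hk₁0 hHk₁ hH1₁ hgC₁0 hCg₁ hG₁ hq₁ hΘH₁ hP₁ bb
    have hq1 : ‖T47 H₁ C₁ εC P₁‖ * ΘH₁ * G₁ ≤ 1 / 2 := (mul_le_mul_of_nonneg_right (mul_le_mul_of_nonneg_right hA₁ hΘH₁) hG₁0).trans hq₁
    rw [hU₁, hK₁]; linarith
  have hU0 : 0 ≤ U₁ := Finset.sum_nonneg fun _ _ => norm_nonneg _
  have hUδb : Uδ ≤ 4 * ((εC + aC) * δΘ * G₁ + ΘH₂ * δG) :=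
    colSum_kernel_sub_le RC₁ hC₁ RC₂ hC₂ hk₁0 hHk₁ hH1₁ hgC₁0 hCg₁ hG₁ hq₁ hk₂0 hHk₂ hH1₂ hgC₂0 hCg₂ hG₂ hq₂ hP₁ hP₂ hδhk0 hδH hδg0 hδg hδG
      hΘH₁ hΘH₂ hδΘ0 hδΘ bb
  have hTsum : ∑ y, T₁ y ≤ G₁ * (1 + U₁) := by
    simp only [hT₁, Finset.sum_add_distrib]
    rw [Finset.sum_comm, mul_add, mul_one, Finset.mul_sum]
    refine add_le_add (hG₁ bb) (Finset.sum_le_sum fun b'' _ => ?_)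
    rw [← Finset.sum_mul]
    exact mul_le_mul_of_nonneg_right (hG₁ b'') (norm_nonneg _)
  have hDsum : ∑ y, D y ≤ δG * (1 + U₁) + ‖T47 H₂ C₂' εC P₂‖ * G₂ * Uδ := by
    simp only [hD, Finset.sum_add_distrib, ← Finset.mul_sum]
    refine add_le_add ?_ ?_
    · rw [Finset.sum_comm, mul_add, mul_one, Finset.mul_sum]
      refine add_le_add (hδG bb) (Finset.sum_le_sum fun b'' _ => ?_)
      rw [← Finset.sum_mul]
      exact mul_le_mul_of_nonneg_right (hδG b'') (norm_nonneg _)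
    · rw [Finset.sum_comm, mul_assoc]
      refine mul_le_mul_of_nonneg_left ?_ (norm_nonneg (T47 H₂ C₂' εC P₂))
      rw [hUδ, Finset.mul_sum]
      refine Finset.sum_le_sum fun b'' _ => ?_
      rw [← Finset.sum_mul]
      exact mul_le_mul_of_nonneg_right (hG₂ b'') (norm_nonneg _)
  have hmain : ∑ b', r b' * ‖NegSup.equiv w' 𝔸 (N₁ (K₁ (single115 (lev₁ := lev₁) (Dc := Dc₁) bb X))) b' -
      NegSup.equiv w' 𝔸 (N₂ (K₂ (single115 (lev₁ := lev₁) (Dc := Dc₂) bb X))) b'‖ ≤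
      (‖T47 H₁ C₁ εC P₁‖ * δΘ'r * ∑ y, T₁ y + Θ'₂r * ∑ y, D y) * ‖X‖ := by
    calc _ ≤ ∑ b', r b' * ((‖T47 H₁ C₁ εC P₁‖ * ∑ y, δhk' b' y * T₁ y + ∑ y, hk'₂ b' y * D y) * ‖X‖) :=
          Finset.sum_le_sum fun b' _ => mul_le_mul_of_nonneg_left (by
            rw [hK₁, hK₂]
            exact norm_equiv_comp_kernel_sub_apply_le RC₁ hC₁ RC₂ hC₂ hgC₁0 hCg₁ hgC₂0 hCg₂ hP₁ hP₂ hδg0 hδg N₁ N₂ hk'₂0 hNk₂ hδhk'0 hδN bb X b') (hr b')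
      _ = (∑ b', r b' * (‖T47 H₁ C₁ εC P₁‖ * ∑ y, δhk' b' y * T₁ y + ∑ y, hk'₂ b' y * D y)) * ‖X‖ := by
          rw [Finset.sum_mul]; exact Finset.sum_congr rfl fun b' _ => by ring
      _ = (‖T47 H₁ C₁ εC P₁‖ * ∑ y, (∑ b', r b' * δhk' b' y) * T₁ y + ∑ y, (∑ b', r b' * hk'₂ b' y) * D y) * ‖X‖ := by
          congr 1
          simp only [mul_add, Finset.sum_add_distrib, Finset.mul_sum, Finset.sum_mul]
          rw [Finset.sum_comm]
          congr 1
          · refine Finset.sum_congr rfl fun y _ => Finset.sum_congr rfl fun b' _ => ?_; ring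
          · rw [Finset.sum_comm]; refine Finset.sum_congr rfl fun y _ => Finset.sum_congr rfl fun b' _ => ?_; ring
      _ ≤ (‖T47 H₁ C₁ εC P₁‖ * ∑ y, δΘ'r * T₁ y + ∑ y, Θ'₂r * D y) * ‖X‖ :=
          mul_le_mul_of_nonneg_right (add_le_add
            (mul_le_mul_of_nonneg_left (Finset.sum_le_sum fun y _ => mul_le_mul_of_nonneg_right (hδΘ'r y) (hT₁0 y)) (norm_nonneg _))
            (Finset.sum_le_sum fun y _ => mul_le_mul_of_nonneg_right (hΘ'₂r y) (hD0 y))) (norm_nonneg _)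
      _ = _ := by rw [← Finset.mul_sum, ← Finset.mul_sum]; ring
  refine hmain.trans (mul_le_mul_of_nonneg_right ?_ (norm_nonneg _))
  have hs0 : 0 ≤ εC + aC := (norm_nonneg _).trans hA₁
  have h1 : ‖T47 H₁ C₁ εC P₁‖ * δΘ'r * ∑ y, T₁ y ≤ (εC + aC) * δΘ'r * (G₁ * 2) :=
    mul_le_mul (mul_le_mul_of_nonneg_right hA₁ hδΘ'r0) (hTsum.trans (mul_le_mul_of_nonneg_left (by linarith) hG₁0))
      (Finset.sum_nonneg fun y _ => hT₁0 y) (mul_nonneg hs0 hδΘ'r0)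
  have hUδ0 : 0 ≤ Uδ := by rw [hUδ]; exact Finset.sum_nonneg fun _ _ => norm_nonneg _
  have h2 : Θ'₂r * ∑ y, D y ≤ Θ'₂r * (δG * 2 + (εC + aC) * G₂ * (4 * ((εC + aC) * δΘ * G₁ + ΘH₂ * δG))) := by
    refine mul_le_mul_of_nonneg_left (hDsum.trans (add_le_add (mul_le_mul_of_nonneg_left (by linarith) hδG0) ?_)) hΘ'₂r0
    exact mul_le_mul (mul_le_mul_of_nonneg_right hA₂ hG₂0) hUδb hUδ0 (mul_nonneg hs0 hG₂0)
  nlinarith [h1, h2]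

end Literature.MathematicalPhysics.QuantumFieldTheory.Balaban1983to89.B11Eq88KernelColumnsCompositeTwoBackgrounds

end
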